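import Mathlib
import HarnessLib

/-!
# `OneFlightGossipEngine.OneFlightLayeredChaos` — junk invisibility for events of a `comap` σ-algebra
(crux stmt-AtomisticToContinuum-14535, helper for every line)

The crux's conditioning σ-algebra is `MeasurableSpace.comap F inferInstance` for a map `F` (coarse past,
partner) that is built from the flow `Φ.flow` at data-dependent times; `F` is measurable on the good set `Φ.good`
(a measurable, conull set — joint measurability of the flow there) but is JUNK off it, so `comap F` need not be a
sub-σ-algebra of the ambient one and its events `E` need not be measurable (their measures are outer measures).
The lemmas below make this harmless, generically: replace `F` by `F̃ := good.piecewise F (const y₀)`, which IS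
measurable (so `comap F̃ ≤` ambient, `Measurable.comap_le`), and note that every `comap F`-event differs from the
corresponding `comap F̃`-event inside the null set `goodᶜ`, so ALL the (outer) measures `μ (X ∩ E)` the crux mentions
are unchanged. No dynamics here; the flow-specific input (measurability of `F` on `Φ.good`) is a separate stub of
any line.
-/

open MeasureTheory Set

namespace Summit.AtomisticToContinuum.HydrodynamicLimit.Theorems

/-- Two events that differ inside a null set have the same trace (outer) measure on every set `X`. [folklore] -/
theorem measure_inter_congr_of_symmDiff_null : ∀ {Ω : Type*} [MeasurableSpace Ω] (μ : MeasureTheory.Measure Ω) {E E' : Set Ω} (N : Set Ω), μ N = 0 → symmDiff E E' ⊆ N → ∀ X : Set Ω, μ (X ∩ E) = μ (X ∩ E') := by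
  intro Ω _ μ E E' N hN hsub X
  have key : ∀ {A B : Set Ω}, A \ B ⊆ N → μ (X ∩ A) ≤ μ (X ∩ B) := by
    intro A B hAB
    calc μ (X ∩ A) ≤ μ ((X ∩ B) ∪ (A \ B)) := measure_mono fun x hx => by
            by_cases hB : x ∈ B
            · exact Or.inl ⟨hx.1, hB⟩
            · exact Or.inr ⟨hx.2, hB⟩
      _ ≤ μ (X ∩ B) + μ (A \ B) := measure_union_le _ _
      _ = μ (X ∩ B) := by rw [measure_mono_null hAB hN, add_zero]
  refine le_antisymm (key fun x hx => hsub (Or.inl hx)) (key fun x hx => hsub (Or.inr hx))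

/-- The preimages of a set under `f` and under its modification `good.piecewise f (const y₀)` differ only off
`good`. [folklore] -/
theorem preimage_symmDiff_preimage_piecewise_subset : ∀ {Ω Y : Type*} (good : Set Ω) [DecidablePred (· ∈ good)] (f : Ω → Y) (y₀ : Y) (S : Set Y), symmDiff (f ⁻¹' S) ((good.piecewise f (fun _ => y₀)) ⁻¹' S) ⊆ goodᶜ := by
  intro Ω Y good _ f y₀ S x hx hgood
  have hfx : good.piecewise f (fun _ => y₀) x = f x := Set.piecewise_eq_of_mem _ _ _ hgood
  rcases hx with ⟨h1, h2⟩ | ⟨h1, h2⟩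
  · exact h2 (by simpa [Set.mem_preimage, hfx] using h1)
  · exact h2 (by simpa [Set.mem_preimage, hfx] using h1)

/-- A map measurable on a measurable set `good`, replaced by a constant off `good`, is measurable. [folklore] -/
theorem measurable_piecewise_const_of_measurable_restrict : ∀ {Ω Y : Type*} [MeasurableSpace Ω] [MeasurableSpace Y] {good : Set Ω} [DecidablePred (· ∈ good)] {f : Ω → Y}, MeasurableSet good → Measurable (good.restrict f) → ∀ y₀ : Y, Measurable (good.piecewise f (fun _ => y₀)) := by
  intro Ω Y _ _ good _ f hgood hf y₀
  refine measurable_of_restrict_of_restrict_compl hgood ?_ ?_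
  · rw [Set.restrict_piecewise]; exact hf
  · rw [Set.restrict_piecewise_compl]; exact measurable_const

/-- **Junk invisibility.** `μ` a measure, `good` measurable and conull, `f` measurable on `good` (junk elsewhere).
Then every event `E` of `comap f` has a version `E'` which is an event of `comap f̃`, `f̃ := good.piecewise f (const y₀)`
— a genuine sub-σ-algebra of the ambient one since `f̃` is measurable — with `E'` measurable and
`μ (X ∩ E) = μ (X ∩ E')` for EVERY set `X` (outer measures). [folklore] -/
theorem exists_measurable_version_of_comap_event : ∀ {Ω Y : Type*} [MeasurableSpace Ω] [MeasurableSpace Y] (μ : MeasureTheory.Measure Ω) {good : Set Ω} [DecidablePred (· ∈ good)] {f : Ω → Y}, MeasurableSet good → μ goodᶜ = 0 → Measurable (good.restrict f) → ∀ (y₀ : Y) (E : Set Ω), MeasurableSet[MeasurableSpace.comap f inferInstance] E → ∃ E' : Set Ω, MeasurableSet[MeasurableSpace.comap (good.piecewise f (fun _ => y₀)) inferInstance] E' ∧ MeasurableSet E' ∧ ∀ X : Set Ω, μ (X ∩ E) = μ (X ∩ E') := by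
  intro Ω Y _ _ μ good _ f hgood hnull hf y₀ E hE
  rcases hE with ⟨S, hS, rfl⟩
  have hmeas : Measurable (good.piecewise f (fun _ => y₀)) :=
    measurable_piecewise_const_of_measurable_restrict hgood hf y₀
  refine ⟨(good.piecewise f (fun _ => y₀)) ⁻¹' S, ⟨S, hS, rfl⟩, hmeas hS, ?_⟩
  exact measure_inter_congr_of_symmDiff_null μ goodᶜ hnull
    (preimage_symmDiff_preimage_piecewise_subset good f y₀ S)

/-- The modified map generates a sub-σ-algebra of the ambient one (restated for convenience: this is
`Measurable.comap_le`). [folklore] -/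
theorem comap_piecewise_le : ∀ {Ω Y : Type*} [m0 : MeasurableSpace Ω] [MeasurableSpace Y] {good : Set Ω} [DecidablePred (· ∈ good)] {f : Ω → Y}, MeasurableSet good → Measurable (good.restrict f) → ∀ y₀ : Y, MeasurableSpace.comap (good.piecewise f (fun _ => y₀)) inferInstance ≤ m0 := by
  intro Ω Y _ _ good _ f hgood hf y₀
  exact (measurable_piecewise_const_of_measurable_restrict hgood hf y₀).comap_le

end Summit.AtomisticToContinuum.HydrodynamicLimit.Theorems
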